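import Literature.Analysis.FunctionSpaces.TorusScalarTrigPoly
import Literature.Analysis.FluidPDE.PassiveScalarProofs
import Literature.Analysis.ODE.GlobalExistence
import HarnessLib

/-!
# The Fourier–Galerkin scheme for the linear transport equation on `T^d`, I: the truncated
  system, conservation of the `L²` norm, global existence

Analysis/FluidPDE proof-support file, first of the discharge of the named fact
`Torus.BardosTitiWiedemann2012_transportExistence` (`Literature/Analysis/FluidPDE/TransportWeakExistence`:
weak solutions of `∂ₜw + b·∇w = 0` with bounded, weakly divergence-free velocity `b`, weakly
continuous in time with non-increasing `L²` norm; Bardos–Titi–Wiedemann 2012, proof of Cor. 2;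
DiPerna–Lions 1989, Prop. II.1) in the case of a velocity that is weakly continuous into `L²` in
time (the case of Székelyhidi's vortex-sheet solutions). The scheme is the Faedo–Galerkin
truncation of the conservative form `∂ₜw + div (b w) = 0` to the trigonometric polynomials with
frequencies in a finite symmetric set `S ⊂ ℤ^d` (Robinson–Rodrigo–Sadowski 2016, §4.1 and Thm. 4.4,
Steps 1–2, for Navier–Stokes; the tree's `Literature/Analysis/FluidPDE/NSHopfGalerkinExistence` is the
vector-valued model of this file). In Fourier coordinates `c : S → ℂ` of the real polynomial
`w = galerkinPoly S c = Re ∑_{k∈S} c_k e_k`, the truncated equation is the linear ODE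

  `ċ_k = G(b(t), c)_k := -2πi ∑ⱼ kⱼ 𝓕(w bⱼ(t))(k) = ∫ w ⟪b(t), ∇e_{-k}⟫`,  `k ∈ S`

(`Torus.transportGalerkinRHS`), and this file proves:

* reality is preserved (`transportGalerkinRHS_mem`: the field maps into the conjugate-symmetric
  real phase space `realScalarSubspace S`), the basic bound `‖G(v,c)‖ ≤ K_S (∫‖v‖) ‖c‖`
  (`norm_transportGalerkinRHS_le`) and real-linearity in `c`;
* **the energy identity** `∑_k conj(c_k) G(v, c)_k = ∫ w ⟪v, ∇w⟫ = 0` for real `c` and an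
  integrable, weakly divergence-free `v` (`sum_conj_mul_transportGalerkinRHS`; the character sum
  `∑_k conj(c_k)(-2πi kⱼ) e_{-k} = ∂ⱼw`, `sum_conj_mul_mFourier_neg`, and
  `∫ w ⟪v, ∇w⟫ = ½∫⟪v, ∇w²⟫ = 0`), whence conservation of `∑_k |c_k(t)|² = ‖w(t)‖²_{L²}` along
  solutions (`sum_norm_sq_eq_of_solution`);
* continuity of `t ↦ G(b(t), c)` when `b` is weakly continuous into `L²`
  (`continuousOn_transportGalerkinRHS`);
* **global existence of real Galerkin solutions with conserved `L²` norm**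
  (`exists_transportGalerkin_solution`; Picard–Lindelöf with the a priori bound from conservation,
  `Literature.Analysis.ODE.exists_solution_of_apriori_bound`).

The passage to the limit `S = freqBall N`, `N → ∞`, is carried out in the sequel files.

## References

* C. Bardos, E. S. Titi, E. Wiedemann, C. R. Math. Acad. Sci. Paris 350 (2012) 757–760, proof of
  Cor. 2 (`BardosTitiWiedemann2012`).
* R. J. DiPerna, P.-L. Lions, Invent. Math. 98 (1989) 511–547, Prop. II.1 (`DiPernaLions1989Invent`).
* J. C. Robinson, J. L. Rodrigo, W. Sadowski, *The three-dimensional Navier–Stokes equations*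
  (CUP 2016), §4.1, Thm. 4.4 Steps 1–2 (`RobinsonRodrigoSadowski2016`).
-/

open MeasureTheory Set Filter Topology Function UnitAddTorus Metric
open scoped ENNReal NNReal InnerProductSpace ComplexConjugate

noncomputable section

namespace Literature.Analysis.FluidPDE

namespace Torus

open Literature.Analysis.FunctionSpaces.Torus

variable {d : Type*} [Fintype d]

/-! ## Scalar coefficient vectors on a finite frequency set -/

section Coeff

variable {S : Finset (d → ℤ)}

variable (S) in
/-- Extension by zero of a scalar coefficient vector on `S` to all of `ℤ^d`. [folklore] -/
def scalarCoeffExt (c : ↥S → ℂ) : (d → ℤ) → ℂ :=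
  fun k => if h : k ∈ S then c ⟨k, h⟩ else 0

/-- On `S` the extension is the given value. [folklore] -/
theorem scalarCoeffExt_of_mem (c : ↥S → ℂ) {k : d → ℤ} (hk : k ∈ S) :
    scalarCoeffExt S c k = c ⟨k, hk⟩ := dif_pos hk

/-- Off `S` the extension vanishes. [folklore] -/
theorem scalarCoeffExt_of_not_mem (c : ↥S → ℂ) {k : d → ℤ} (hk : k ∉ S) :
    scalarCoeffExt S c k = 0 := dif_neg hk

/-- On elements of `S` the extension is the given value. [folklore] -/
@[simp]
theorem scalarCoeffExt_coe (c : ↥S → ℂ) (k : ↥S) : scalarCoeffExt S c k = c k := by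
  rw [scalarCoeffExt_of_mem c k.2]

/-- Extension by zero is additive. [folklore] -/
theorem scalarCoeffExt_add (c c' : ↥S → ℂ) :
    scalarCoeffExt S (c + c') = scalarCoeffExt S c + scalarCoeffExt S c' := by
  funext k
  by_cases hk : k ∈ S <;> simp [scalarCoeffExt, hk]

/-- Extension by zero commutes with real scalars. [folklore] -/
theorem scalarCoeffExt_smul (a : ℝ) (c : ↥S → ℂ) :
    scalarCoeffExt S (a • c) = a • scalarCoeffExt S c := by
  funext k
  by_cases hk : k ∈ S <;> simp [scalarCoeffExt, hk]

/-- Sums over `ℤ^d`-indexed extensions reduce to sums over `S`. [folklore] -/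
theorem sum_scalarCoeffExt {M : Type*} [AddCommMonoid M] (F : (d → ℤ) → ℂ → M)
    (c : ↥S → ℂ) : ∑ k ∈ S, F k (scalarCoeffExt S c k) = ∑ k : ↥S, F k (c k) := by
  rw [← Finset.sum_coe_sort]
  refine Finset.sum_congr rfl fun k _ => ?_
  rw [scalarCoeffExt_coe]

/-- **Real scalar coefficient vectors**: `c (-k) = conj (c k)` on `S`. [folklore] -/
def IsRealScalarCoeff (c : ↥S → ℂ) : Prop :=
  ∀ k l : ↥S, (l : d → ℤ) = -(k : d → ℤ) → c l = conj (c k)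

/-- Real coefficient vectors extend to conjugate-symmetric families on a symmetric `S`. [folklore] -/
theorem IsRealScalarCoeff.isConjSymmScalar (hS : ∀ k ∈ S, -k ∈ S) {c : ↥S → ℂ}
    (hc : IsRealScalarCoeff c) : IsConjSymmScalar (scalarCoeffExt S c) := by
  intro k
  by_cases hk : k ∈ S
  · rw [scalarCoeffExt_of_mem c hk, scalarCoeffExt_of_mem c (hS k hk)]
    exact hc ⟨k, hk⟩ ⟨-k, hS k hk⟩ rfl
  · have hnk : -k ∉ S := fun h => hk (by simpa using hS (-k) h)
    rw [scalarCoeffExt_of_not_mem c hk, scalarCoeffExt_of_not_mem c hnk, map_zero]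

variable (S) in
/-- **The real Galerkin phase space** for scalars: the real subspace of `S → ℂ` of
conjugate-symmetric coefficient vectors (the Fourier coordinates of the real trigonometric
polynomials with frequencies in `S`). [folklore] -/
def realScalarSubspace : Submodule ℝ (↥S → ℂ) where
  carrier := {c | IsRealScalarCoeff c}
  zero_mem' := fun k l _ => by simp
  add_mem' := by
    intro c c' hc hc' k l hkl
    simp only [Pi.add_apply, map_add, hc k l hkl, hc' k l hkl]
  smul_mem' := by
    intro a c hc k l hkl
    simp only [Pi.smul_apply, Complex.real_smul, map_mul, Complex.conj_ofReal, hc k l hkl]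

omit [Fintype d] in
/-- Membership in the real phase space, unfolded. [folklore] -/
theorem mem_realScalarSubspace {c : ↥S → ℂ} : c ∈ realScalarSubspace S ↔ IsRealScalarCoeff c := Iff.rfl

end Coeff

/-! ## The Galerkin polynomial of a coefficient vector -/

section Poly

variable {S : Finset (d → ℤ)}

variable (S) in
/-- The real trigonometric polynomial with coefficient vector `c` on `S`. [folklore] -/
def galerkinPoly (c : ↥S → ℂ) : UnitAddTorus d → ℝ := reTrigPoly S (scalarCoeffExt S c)

/-- Galerkin polynomials are smooth. [folklore] -/
theorem isSmooth_galerkinPoly (c : ↥S → ℂ) : IsSmooth (galerkinPoly S c) := isSmooth_reTrigPoly _ _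

/-- Pointwise: `galerkinPoly S c x = ∑_{k∈S} Re (e_k(x) c_k)`. [folklore] -/
theorem galerkinPoly_apply (c : ↥S → ℂ) (x : UnitAddTorus d) :
    galerkinPoly S c x = ∑ k : ↥S, (mFourier (k : d → ℤ) x * c k).re := by
  rw [galerkinPoly, reTrigPoly_eq_sum]
  exact sum_scalarCoeffExt (fun k z => (mFourier k x * z).re) c

/-- `galerkinPoly` is real-linear in the coefficients. [folklore] -/
theorem galerkinPoly_add (c c' : ↥S → ℂ) : galerkinPoly S (c + c') = galerkinPoly S c + galerkinPoly S c' := by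
  funext x
  simp only [galerkinPoly_apply, Pi.add_apply, mul_add, Complex.add_re, Finset.sum_add_distrib]

/-- `galerkinPoly` is real-homogeneous in the coefficients. [folklore] -/
theorem galerkinPoly_smul (a : ℝ) (c : ↥S → ℂ) : galerkinPoly S (a • c) = a • galerkinPoly S c := by
  funext x
  simp only [galerkinPoly_apply, Pi.smul_apply, Complex.real_smul, smul_eq_mul, Finset.mul_sum]
  refine Finset.sum_congr rfl fun k _ => ?_
  rw [mul_left_comm, Complex.re_ofReal_mul]

/-- `galerkinPoly` respects differences of coefficients. [folklore] -/
theorem galerkinPoly_sub (c c' : ↥S → ℂ) : galerkinPoly S (c - c') = galerkinPoly S c - galerkinPoly S c' := by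
  rw [sub_eq_add_neg, galerkinPoly_add, show -c' = (-1 : ℝ) • c' by simp, galerkinPoly_smul]
  funext x
  simp only [Pi.add_apply, Pi.smul_apply, Pi.sub_apply, smul_eq_mul]
  ring

/-- **Sup bound**: `|galerkinPoly S c (x)| ≤ |S| ‖c‖`. [folklore] -/
theorem abs_galerkinPoly_le (c : ↥S → ℂ) (x : UnitAddTorus d) :
    |galerkinPoly S c x| ≤ Fintype.card ↥S * ‖c‖ := by
  rw [galerkinPoly_apply]
  calc |∑ k : ↥S, (mFourier (k : d → ℤ) x * c k).re| ≤ ∑ k : ↥S, |(mFourier (k : d → ℤ) x * c k).re| :=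
        Finset.abs_sum_le_sum_abs _ _
    _ ≤ ∑ _k : ↥S, ‖c‖ := Finset.sum_le_sum fun k _ => by
        calc |(mFourier (k : d → ℤ) x * c k).re| ≤ ‖mFourier (k : d → ℤ) x * c k‖ := Complex.abs_re_le_norm _
          _ ≤ 1 * ‖c k‖ := by
              rw [norm_mul]
              exact mul_le_mul_of_nonneg_right
                (((mFourier (k : d → ℤ)).norm_coe_le_norm x).trans_eq mFourier_norm) (norm_nonneg _)
          _ ≤ ‖c‖ := by rw [one_mul]; exact norm_le_pi_norm c k
    _ = Fintype.card ↥S * ‖c‖ := by rw [Finset.sum_const, Finset.card_univ, nsmul_eq_mul]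

end Poly

/-! ## The Galerkin vector field of the transport equation -/

section RHS

variable {S : Finset (d → ℤ)}

variable (S) in
/-- **The Galerkin vector field of the transport equation** `∂ₜw + div (v w) = 0` projected on the
frequencies in `S`, in Fourier coordinates: for a velocity slice `v` and a coefficient vector
`c` with polynomial `w = galerkinPoly S c`,
`G(v, c)_k = -2πi ∑ⱼ kⱼ 𝓕(w vⱼ)(k) = ∫ w ⟪v, ∇e_{-k}⟫`, `k ∈ S` — the `k`-th Fourier coefficient of
`-div (v w)` (Robinson–Rodrigo–Sadowski 2016, §4.1, the Galerkin truncation, here for the linear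
transport equation). [folklore] -/
def transportGalerkinRHS (v : UnitAddTorus d → EuclideanSpace ℝ d) (c : ↥S → ℂ) : ↥S → ℂ :=
  fun k => -(2 * Real.pi * Complex.I) *
    ∑ j, (((k : d → ℤ) j : ℝ) : ℂ) *
      mFourierCoeff (fun x => ((galerkinPoly S c x * v x j : ℝ) : ℂ)) (k : d → ℤ)

/-- The products `w vⱼ` are integrable for `v ∈ L¹`. [folklore] -/
theorem integrable_galerkinPoly_mul {v : UnitAddTorus d → EuclideanSpace ℝ d} (hv : Integrable v volume)
    (c : ↥S → ℂ) (j : d) : Integrable (fun x => galerkinPoly S c x * v x j) volume := by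
  have hvj : Integrable (fun x => v x j) volume := (EuclideanSpace.proj j : EuclideanSpace ℝ d →L[ℝ] ℝ).integrable_comp hv
  refine (hvj.norm.const_mul (Fintype.card ↥S * ‖c‖)).mono'
    ((continuous_reTrigPoly _ _).aestronglyMeasurable.mul hvj.1) (ae_of_all _ fun x => ?_)
  rw [norm_mul, Real.norm_eq_abs]
  exact mul_le_mul_of_nonneg_right (abs_galerkinPoly_le c x) (norm_nonneg _)

/-- Integrability of the complexified products. [folklore] -/
theorem integrable_ofReal_galerkinPoly_mul {v : UnitAddTorus d → EuclideanSpace ℝ d} (hv : Integrable v volume)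
    (c : ↥S → ℂ) (j : d) : Integrable (fun x => ((galerkinPoly S c x * v x j : ℝ) : ℂ)) volume :=
  (integrable_galerkinPoly_mul hv c j).ofReal

/-- **Additivity in the coefficients** (integrable velocity). [folklore] -/
theorem transportGalerkinRHS_add {v : UnitAddTorus d → EuclideanSpace ℝ d} (hv : Integrable v volume)
    (c c' : ↥S → ℂ) :
    transportGalerkinRHS S v (c + c') = transportGalerkinRHS S v c + transportGalerkinRHS S v c' := by
  funext k
  simp only [transportGalerkinRHS, Pi.add_apply]
  rw [← mul_add, ← Finset.sum_add_distrib]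
  congr 1
  refine Finset.sum_congr rfl fun j _ => ?_
  rw [← mul_add]
  congr 1
  have h : (fun x => ((galerkinPoly S (c + c') x * v x j : ℝ) : ℂ)) =
      (fun x => ((galerkinPoly S c x * v x j : ℝ) : ℂ)) + fun x => ((galerkinPoly S c' x * v x j : ℝ) : ℂ) := by
    funext x
    simp only [galerkinPoly_add, Pi.add_apply, add_mul, Complex.ofReal_add, Complex.ofReal_mul]
  rw [h, mFourierCoeff_eq_integral_volume, mFourierCoeff_eq_integral_volume, mFourierCoeff_eq_integral_volume,
    ← integral_add (integrable_mFourier_smul' (integrable_ofReal_galerkinPoly_mul hv c j) _)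
      (integrable_mFourier_smul' (integrable_ofReal_galerkinPoly_mul hv c' j) _)]
  refine integral_congr_ae (ae_of_all _ fun x => ?_)
  simp only [Pi.add_apply, smul_add]

/-- **Real homogeneity in the coefficients.** [folklore] -/
theorem transportGalerkinRHS_smul (v : UnitAddTorus d → EuclideanSpace ℝ d) (a : ℝ) (c : ↥S → ℂ) :
    transportGalerkinRHS S v (a • c) = a • transportGalerkinRHS S v c := by
  funext k
  simp only [transportGalerkinRHS, Pi.smul_apply, Complex.real_smul, Finset.mul_sum]
  refine Finset.sum_congr rfl fun j _ => ?_
  have h : (fun x => ((galerkinPoly S (a • c) x * v x j : ℝ) : ℂ)) =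
      fun x => (a : ℂ) • ((galerkinPoly S c x * v x j : ℝ) : ℂ) := by
    funext x
    simp only [galerkinPoly_smul, Pi.smul_apply, smul_eq_mul, Complex.ofReal_mul]
    ring
  rw [h, mFourierCoeff_eq_integral_volume, mFourierCoeff_eq_integral_volume]
  simp_rw [smul_comm _ (a : ℂ), integral_smul, smul_eq_mul]
  ring

/-- The Galerkin field is real-linear in the coefficients; difference form. [folklore] -/
theorem transportGalerkinRHS_sub {v : UnitAddTorus d → EuclideanSpace ℝ d} (hv : Integrable v volume)
    (c c' : ↥S → ℂ) :
    transportGalerkinRHS S v (c - c') = transportGalerkinRHS S v c - transportGalerkinRHS S v c' := by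
  rw [sub_eq_add_neg, transportGalerkinRHS_add hv, show -c' = (-1 : ℝ) • c' by simp,
    transportGalerkinRHS_smul]
  simp [sub_eq_add_neg]

variable (S) in
/-- The Lipschitz constant of the Galerkin field per unit `L¹` norm of the velocity. [folklore] -/
def galerkinConst : ℝ := 2 * Real.pi * (∑ k ∈ S, ∑ j, |((k j : ℤ) : ℝ)|) * Fintype.card ↥S

/-- The constant is nonnegative. [folklore] -/
theorem galerkinConst_nonneg : 0 ≤ galerkinConst S := by
  unfold galerkinConst
  positivity

/-- **The basic bound**: `‖G(v, c)‖ ≤ K_S (∫ ‖v‖) ‖c‖`. [folklore] -/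
theorem norm_transportGalerkinRHS_le {v : UnitAddTorus d → EuclideanSpace ℝ d} (hv : Integrable v volume)
    (c : ↥S → ℂ) : ‖transportGalerkinRHS S v c‖ ≤ galerkinConst S * (∫ x, ‖v x‖) * ‖c‖ := by
  have hK : ∀ k : ↥S, ‖transportGalerkinRHS S v c k‖ ≤ galerkinConst S * (∫ x, ‖v x‖) * ‖c‖ := by
    intro k
    rw [transportGalerkinRHS, norm_mul]
    have h2π : ‖-(2 * (Real.pi : ℂ) * Complex.I)‖ = 2 * Real.pi := by
      rw [norm_neg, norm_mul, norm_mul, Complex.norm_I, mul_one, Complex.norm_ofNat, Complex.norm_real,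
        Real.norm_of_nonneg Real.pi_pos.le]
    rw [h2π]
    have hF : ∀ j, ‖mFourierCoeff (fun x => ((galerkinPoly S c x * v x j : ℝ) : ℂ)) (k : d → ℤ)‖ ≤
        Fintype.card ↥S * ‖c‖ * ∫ x, ‖v x‖ := by
      intro j
      rw [mFourierCoeff_eq_integral_volume]
      calc ‖∫ x, mFourier (-(k : d → ℤ)) x • ((galerkinPoly S c x * v x j : ℝ) : ℂ)‖
          ≤ ∫ x, ‖mFourier (-(k : d → ℤ)) x • ((galerkinPoly S c x * v x j : ℝ) : ℂ)‖ :=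
            norm_integral_le_integral_norm _
        _ ≤ ∫ x, Fintype.card ↥S * ‖c‖ * ‖v x‖ := by
            refine integral_mono_of_nonneg (ae_of_all _ fun x => norm_nonneg _) (hv.norm.const_mul _)
              (ae_of_all _ fun x => ?_)
            show ‖mFourier (-(k : d → ℤ)) x • ((galerkinPoly S c x * v x j : ℝ) : ℂ)‖ ≤ Fintype.card ↥S * ‖c‖ * ‖v x‖
            rw [norm_smul, Complex.norm_real, norm_mul, Real.norm_eq_abs]
            calc ‖mFourier (-(k : d → ℤ)) x‖ * (|galerkinPoly S c x| * ‖v x j‖) ≤ 1 * (|galerkinPoly S c x| * ‖v x j‖) :=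
                  mul_le_mul_of_nonneg_right
                    (((mFourier (-(k : d → ℤ))).norm_coe_le_norm x).trans_eq mFourier_norm) (by positivity)
              _ ≤ Fintype.card ↥S * ‖c‖ * ‖v x‖ := by
                  rw [one_mul]
                  exact mul_le_mul (abs_galerkinPoly_le c x) (PiLp.norm_apply_le (v x) j) (norm_nonneg _)
                    (by positivity)
        _ = Fintype.card ↥S * ‖c‖ * ∫ x, ‖v x‖ := integral_const_mul _ _
    calc 2 * Real.pi * ‖∑ j, ((((k : d → ℤ) j : ℝ) : ℂ)) * mFourierCoeff (fun x => ((galerkinPoly S c x * v x j : ℝ) : ℂ)) (k : d → ℤ)‖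
        ≤ 2 * Real.pi * ∑ j, |(((k : d → ℤ) j : ℤ) : ℝ)| * (Fintype.card ↥S * ‖c‖ * ∫ x, ‖v x‖) := by
          refine mul_le_mul_of_nonneg_left ((norm_sum_le _ _).trans (Finset.sum_le_sum fun j _ => ?_)) (by positivity)
          rw [norm_mul, Complex.norm_real, Real.norm_eq_abs]
          exact mul_le_mul_of_nonneg_left (hF j) (abs_nonneg _)
      _ = 2 * Real.pi * (∑ j, |(((k : d → ℤ) j : ℤ) : ℝ)|) * Fintype.card ↥S * (∫ x, ‖v x‖) * ‖c‖ := by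
          rw [← Finset.sum_mul]; ring
      _ ≤ galerkinConst S * (∫ x, ‖v x‖) * ‖c‖ := by
          unfold galerkinConst
          have hk : (∑ j, |(((k : d → ℤ) j : ℤ) : ℝ)|) ≤ ∑ k' ∈ S, ∑ j, |((k' j : ℤ) : ℝ)| :=
            Finset.single_le_sum (f := fun k' : d → ℤ => ∑ j, |((k' j : ℤ) : ℝ)|)
              (fun k' _ => Finset.sum_nonneg fun j _ => abs_nonneg _) k.2
          have h1 : 0 ≤ ∫ x, ‖v x‖ := integral_nonneg fun x => norm_nonneg _
          gcongr
  exact (pi_norm_le_iff_of_nonneg (by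
    have h1 : 0 ≤ ∫ x, ‖v x‖ := integral_nonneg fun x => norm_nonneg _
    exact mul_nonneg (mul_nonneg galerkinConst_nonneg h1) (norm_nonneg _))).2 hK

end RHS

/-! ## Reality is preserved, and the energy identity -/

section Structure

variable {S : Finset (d → ℤ)}

/-- **The Galerkin field takes values in the real phase space** (Fourier coefficients of real
functions are conjugate symmetric), for every coefficient vector. [folklore] -/
theorem transportGalerkinRHS_mem (v : UnitAddTorus d → EuclideanSpace ℝ d) (c : ↥S → ℂ) :
    transportGalerkinRHS S v c ∈ realScalarSubspace S := by
  intro k l hkl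
  simp only [transportGalerkinRHS]
  have hF : ∀ j, mFourierCoeff (fun x => ((galerkinPoly S c x * v x j : ℝ) : ℂ)) (l : d → ℤ) =
      conj (mFourierCoeff (fun x => ((galerkinPoly S c x * v x j : ℝ) : ℂ)) (k : d → ℤ)) := by
    intro j
    rw [hkl]
    exact isConjSymmScalar_mFourierCoeff _ _
  simp_rw [hF, hkl, map_mul, map_neg, map_sum, map_mul, Complex.conj_ofReal, map_ofNat, Complex.conj_I,
    Pi.neg_apply, Int.cast_neg, Complex.ofReal_neg]
  simp only [neg_mul, Finset.sum_neg_distrib, mul_neg]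

variable [DecidableEq d]

/-- **The conjugate-weighted character sum is the partial derivative**: for real `c` on a
symmetric `S` with polynomial `w = galerkinPoly S c`,
`∑_{k∈S} conj(c_k) (-2πi kⱼ) e_{-k}(x) = ∂ⱼ w (x)`. [folklore] -/
theorem sum_conj_mul_mFourier_neg (hS : ∀ k ∈ S, -k ∈ S) {c : ↥S → ℂ} (hc : IsRealScalarCoeff c)
    (j : d) (x : UnitAddTorus d) :
    ∑ k : ↥S, conj (c k) * ((-(2 * Real.pi * Complex.I) * (((k : d → ℤ) j : ℝ) : ℂ)) * mFourier (-(k : d → ℤ)) x) =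
      ((partialDeriv j (galerkinPoly S c) x : ℝ) : ℂ) := by
  have hcs : IsConjSymmScalar (scalarCoeffExt S c) := hc.isConjSymmScalar hS
  rw [galerkinPoly, partialDeriv_reTrigPoly, ofReal_reTrigPoly hS (hcs.deriv j), trigPoly_apply]
  -- pass from the subtype sum to a sum over `S`, then reindex `k ↦ -k`
  rw [← sum_scalarCoeffExt (fun k z => conj z * ((-(2 * Real.pi * Complex.I) * ((k j : ℝ) : ℂ)) * mFourier (-k) x)) c]
  refine Finset.sum_nbij' (fun k => -k) (fun k => -k) hS hS (fun k _ => neg_neg k) (fun k _ => neg_neg k)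
    fun k hk => ?_
  have hck : conj (scalarCoeffExt S c k) = scalarCoeffExt S c (-k) := by
    rw [hcs k]
  rw [hck]
  simp only [Pi.neg_apply, Int.cast_neg, smul_eq_mul]
  push_cast
  ring

/-- **The energy identity of the Galerkin field**: for real `c` on a symmetric `S` and an
integrable, weakly divergence-free velocity `v`,
`∑_k conj(c_k) G(v,c)_k = ∫ w ⟪v, ∇w⟫ = 0` (`w = galerkinPoly S c`; the transport term is
conservative). [folklore] -/
theorem sum_conj_mul_transportGalerkinRHS (hS : ∀ k ∈ S, -k ∈ S) {c : ↥S → ℂ} (hc : IsRealScalarCoeff c)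
    {v : UnitAddTorus d → EuclideanSpace ℝ d} (hv : Integrable v volume) (hdiv : IsWeaklyDivFree v) :
    ∑ k : ↥S, conj (c k) * transportGalerkinRHS S v c k = 0 := by
  set w := galerkinPoly S c with hw
  have hint : ∀ (k : ↥S) (j : d), Integrable (fun x => mFourier (-(k : d → ℤ)) x • ((w x * v x j : ℝ) : ℂ)) volume :=
    fun k j => integrable_mFourier_smul' (integrable_ofReal_galerkinPoly_mul hv c j) _
  -- Step 1: each `conj(c_k) G_k` as one integral of a finite sum
  have h1 : ∀ k : ↥S, conj (c k) * transportGalerkinRHS S v c k =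
      ∫ x, ∑ j, ((w x * v x j : ℝ) : ℂ) *
        (conj (c k) * ((-(2 * Real.pi * Complex.I) * (((k : d → ℤ) j : ℝ) : ℂ)) * mFourier (-(k : d → ℤ)) x)) := by
    intro k
    have hsummand : ∀ j, Integrable (fun x => ((w x * v x j : ℝ) : ℂ) *
        (conj (c k) * ((-(2 * Real.pi * Complex.I) * (((k : d → ℤ) j : ℝ) : ℂ)) * mFourier (-(k : d → ℤ)) x))) volume :=
      fun j => ((hint k j).const_mul (conj (c k) * (-(2 * Real.pi * Complex.I) * (((k : d → ℤ) j : ℝ) : ℂ)))).congr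
        (ae_of_all _ fun x => by simp only [smul_eq_mul]; ring)
    simp only [transportGalerkinRHS]
    rw [Finset.mul_sum, Finset.mul_sum, integral_finsetSum _ fun j _ => hsummand j]
    refine Finset.sum_congr rfl fun j _ => ?_
    rw [mFourierCoeff_eq_integral_volume,
      show (∫ x, ((w x * v x j : ℝ) : ℂ) *
          (conj (c k) * ((-(2 * Real.pi * Complex.I) * (((k : d → ℤ) j : ℝ) : ℂ)) * mFourier (-(k : d → ℤ)) x))) =
        (conj (c k) * (-(2 * Real.pi * Complex.I) * (((k : d → ℤ) j : ℝ) : ℂ))) *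
          ∫ x, mFourier (-(k : d → ℤ)) x • ((w x * v x j : ℝ) : ℂ) from by
        rw [← integral_const_mul]
        exact integral_congr_ae (ae_of_all _ fun x => by simp only [smul_eq_mul]; ring)]
    ring
  -- Step 2: sum over `k`, swap with the integral, and recognise `∂ⱼ w`
  have h2 : ∑ k : ↥S, conj (c k) * transportGalerkinRHS S v c k =
      ∫ x, ∑ j, ((w x * v x j : ℝ) : ℂ) * ((partialDeriv j w x : ℝ) : ℂ) := by
    simp_rw [h1]
    have hsummand : ∀ (k : ↥S) (j : d), Integrable (fun x => ((w x * v x j : ℝ) : ℂ) *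
        (conj (c k) * ((-(2 * Real.pi * Complex.I) * (((k : d → ℤ) j : ℝ) : ℂ)) * mFourier (-(k : d → ℤ)) x))) volume :=
      fun k j => ((hint k j).const_mul (conj (c k) * (-(2 * Real.pi * Complex.I) * (((k : d → ℤ) j : ℝ) : ℂ)))).congr
        (ae_of_all _ fun x => by simp only [smul_eq_mul]; ring)
    rw [← integral_finsetSum _ fun k _ => integrable_finsetSum _ fun j _ => hsummand k j]
    refine integral_congr_ae (ae_of_all _ fun x => ?_)
    show ∑ k : ↥S, ∑ j, ((w x * v x j : ℝ) : ℂ) *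
        (conj (c k) * ((-(2 * Real.pi * Complex.I) * (((k : d → ℤ) j : ℝ) : ℂ)) * mFourier (-(k : d → ℤ)) x)) =
      ∑ j, ((w x * v x j : ℝ) : ℂ) * ((partialDeriv j w x : ℝ) : ℂ)
    rw [Finset.sum_comm]
    refine Finset.sum_congr rfl fun j _ => ?_
    rw [← Finset.mul_sum, sum_conj_mul_mFourier_neg hS hc j x]
  -- Step 3: the real identity `∫ w ⟪v, ∇w⟫ = 0`
  have h3 : ∀ x, ∑ j, ((w x * v x j : ℝ) : ℂ) * ((partialDeriv j w x : ℝ) : ℂ) =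
      ((w x * ⟪v x, FunctionSpaces.Torus.gradient w x⟫_ℝ : ℝ) : ℂ) := by
    intro x
    rw [PiLp.inner_apply, Finset.mul_sum]
    push_cast
    refine Finset.sum_congr rfl fun j _ => ?_
    have hg : FunctionSpaces.Torus.gradient w x j = partialDeriv j w x := gradient_reTrigPoly_apply _ _ x j
    rw [RCLike.inner_apply, conj_trivial, hg]
    push_cast
    ring
  rw [h2]
  simp_rw [h3]
  rw [integral_complex_ofReal, integral_mul_inner_gradient_eq_zero (isSmooth_galerkinPoly c) hdiv, Complex.ofReal_zero]

/-- Real form of the energy identity: `Re ∑_k conj(c_k) G(v,c)_k = 0`. [folklore] -/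
theorem re_sum_conj_mul_transportGalerkinRHS (hS : ∀ k ∈ S, -k ∈ S) {c : ↥S → ℂ} (hc : IsRealScalarCoeff c)
    {v : UnitAddTorus d → EuclideanSpace ℝ d} (hv : Integrable v volume) (hdiv : IsWeaklyDivFree v) :
    (∑ k : ↥S, conj (c k) * transportGalerkinRHS S v c k).re = 0 := by
  rw [sum_conj_mul_transportGalerkinRHS hS hc hv hdiv, Complex.zero_re]

end Structure

/-! ## Continuity in time of the Galerkin field along a weakly continuous velocity -/

section Continuity

variable {S : Finset (d → ℤ)} [DecidableEq d]

/-- The cosine/sine integrals of `w bⱼ(t)` as pairings of `b(t)` with a fixed `L²` field. [folklore] -/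
theorem integral_galerkinPoly_mul_mul_eq_inner (c : ↥S → ℂ) (b : UnitAddTorus d → EuclideanSpace ℝ d)
    (φ : UnitAddTorus d → ℝ) (j : d) :
    ∫ x, galerkinPoly S c x * b x j * φ x =
      ∫ x, ⟪b x, (galerkinPoly S c x * φ x) • EuclideanSpace.single j (1 : ℝ)⟫_ℝ := by
  refine integral_congr_ae (ae_of_all _ fun x => ?_)
  show galerkinPoly S c x * b x j * φ x = ⟪b x, (galerkinPoly S c x * φ x) • EuclideanSpace.single j (1 : ℝ)⟫_ℝ
  rw [real_inner_smul_right, EuclideanSpace.inner_single_right, conj_trivial]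
  ring

/-- The fixed fields `x ↦ (w(x) φ(x)) eⱼ` are in `L²` for continuous `φ`. [folklore] -/
theorem memLp_single_galerkinPoly_mul (c : ↥S → ℂ) {φ : UnitAddTorus d → ℝ} (hφ : Continuous φ) (j : d) :
    MemLp (fun x => (galerkinPoly S c x * φ x) • EuclideanSpace.single j (1 : ℝ)) 2 volume := by
  have hc : Continuous fun x => (galerkinPoly S c x * φ x) • EuclideanSpace.single j (1 : ℝ) :=
    ((continuous_reTrigPoly _ _).mul hφ).smul continuous_const
  exact hc.memLp_of_hasCompactSupport (HasCompactSupport.of_compactSpace _)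

/-- **Continuity in time of the Galerkin field** along a velocity that is weakly continuous into
`L²` on `[0,T]` with integrable slices. [folklore] -/
theorem continuousOn_transportGalerkinRHS {T : ℝ} {b : ℝ → UnitAddTorus d → EuclideanSpace ℝ d}
    (hb1 : ∀ t ∈ Icc 0 T, Integrable (b t) volume)
    (hbc : ∀ g : UnitAddTorus d → EuclideanSpace ℝ d, MemLp g 2 volume →
      ContinuousOn (fun t => ∫ x, ⟪b t x, g x⟫_ℝ) (Icc 0 T))
    (c : ↥S → ℂ) : ContinuousOn (fun t => transportGalerkinRHS S (b t) c) (Icc 0 T) := by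
  refine continuousOn_pi.2 fun k => ?_
  simp only [transportGalerkinRHS]
  refine continuousOn_const.mul (continuousOn_finsetSum _ fun j _ => continuousOn_const.mul ?_)
  -- the Fourier coefficient of `w bⱼ(t)` at `k`, through its real and imaginary parts
  set F : ℝ → ℂ := fun t => mFourierCoeff (fun x => ((galerkinPoly S c x * b t x j : ℝ) : ℂ)) (k : d → ℤ) with hF
  have hre : ContinuousOn (fun t => (F t).re) (Icc 0 T) := by
    have h := hbc _ (memLp_single_galerkinPoly_mul c (continuous_reTrigPoly {-(k : d → ℤ)} (fun _ => 1)) j)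
    refine h.congr fun t ht => ?_
    show (F t).re = _
    rw [hF, re_mFourierCoeff_ofReal (integrable_galerkinPoly_mul (hb1 t ht) c j),
      integral_galerkinPoly_mul_mul_eq_inner]
  have him : ContinuousOn (fun t => (F t).im) (Icc 0 T) := by
    have h := hbc _ (memLp_single_galerkinPoly_mul c (continuous_reTrigPoly {-(k : d → ℤ)} (fun _ => -Complex.I)) j)
    refine h.congr fun t ht => ?_
    show (F t).im = _
    rw [hF, im_mFourierCoeff_ofReal (integrable_galerkinPoly_mul (hb1 t ht) c j),
      integral_galerkinPoly_mul_mul_eq_inner]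
  have hsum : ContinuousOn (fun t => ((F t).re : ℂ) + ((F t).im : ℂ) * Complex.I) (Icc 0 T) :=
    (Complex.continuous_ofReal.comp_continuousOn hre).add
      ((Complex.continuous_ofReal.comp_continuousOn him).mul continuousOn_const)
  exact hsum.congr fun t _ => (Complex.re_add_im (F t)).symm

end Continuity

/-! ## The Galerkin solutions: global existence and conservation of the `L²` norm -/

section Existence

variable {S : Finset (d → ℤ)} [DecidableEq d]

omit [Fintype d] [DecidableEq d] in
/-- Derivative of the coefficient energy `∑_k ‖β k‖²` along a differentiable curve in `S → ℂ`:
`d/dt ∑_k ‖β k‖² = ∑_k 2 Re (conj(β k) β' k)`. [folklore] -/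
theorem hasDerivWithinAt_sum_norm_sq_scalar {β : ℝ → ↥S → ℂ} {u : ↥S → ℂ} {s : Set ℝ} {t : ℝ}
    (h : HasDerivWithinAt β u s t) :
    HasDerivWithinAt (fun τ => ∑ k, ‖β τ k‖ ^ 2) (∑ k, 2 * (conj (β t k) * u k).re) s t := by
  have hk : ∀ k : ↥S, HasDerivWithinAt (fun τ => β τ k) (u k) s t := fun k =>
    (ContinuousLinearMap.proj (R := ℝ) (φ := fun _ : ↥S => ℂ) k).hasFDerivAt.comp_hasDerivWithinAt t h
  have := HasDerivWithinAt.fun_sum (u := Finset.univ) fun k _ => (hk k).norm_sq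
  have key : ∀ k : ↥S, 2 * ⟪β t k, u k⟫_ℝ = 2 * (conj (β t k) * u k).re := fun k => by
    rw [Complex.inner, mul_comm (u k)]
  simp only [key] at this
  exact this

omit [Fintype d] [DecidableEq d] in
/-- `‖c‖ ≤ (∑_k ‖c k‖²)^{1/2}` for the sup norm on `S → ℂ`. [folklore] -/
theorem norm_le_sqrt_sum_norm_sq_scalar (c : ↥S → ℂ) : ‖c‖ ≤ Real.sqrt (∑ k, ‖c k‖ ^ 2) := by
  refine (pi_norm_le_iff_of_nonneg (Real.sqrt_nonneg _)).2 fun k => ?_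
  rw [← Real.sqrt_sq (norm_nonneg (c k))]
  exact Real.sqrt_le_sqrt (Finset.single_le_sum (f := fun k => ‖c k‖ ^ 2) (fun k _ => sq_nonneg _) (Finset.mem_univ k))

/-- **Conservation of the coefficient energy along Galerkin solutions**: if `α' = G(b(t), α)`
within `[0, s]` with real values and `b(t)` integrable and weakly divergence free on `[0, s]`, then
`∑_k ‖α t k‖² = ∑_k ‖α 0 k‖²` on `[0, s]`. [folklore] -/
theorem sum_norm_sq_eq_of_solution (hS : ∀ k ∈ S, -k ∈ S) {s : ℝ}
    {b : ℝ → UnitAddTorus d → EuclideanSpace ℝ d} (hb1 : ∀ t ∈ Icc 0 s, Integrable (b t) volume)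
    (hdiv : ∀ t ∈ Icc 0 s, IsWeaklyDivFree (b t)) {α : ℝ → ↥S → ℂ}
    (hα : ∀ t ∈ Icc 0 s, HasDerivWithinAt α (transportGalerkinRHS S (b t) (α t)) (Icc 0 s) t)
    (hreal : ∀ t ∈ Icc 0 s, IsRealScalarCoeff (α t)) :
    ∀ t ∈ Icc 0 s, ∑ k, ‖α t k‖ ^ 2 = ∑ k, ‖α 0 k‖ ^ 2 := by
  intro t ht
  rcases eq_or_lt_of_le ht.1 with h0 | h0
  · rw [← h0]
  have hs : 0 < s := h0.trans_le ht.2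
  have hderiv : ∀ τ ∈ Icc 0 s, HasDerivWithinAt (fun τ => ∑ k, ‖α τ k‖ ^ 2) 0 (Icc 0 s) τ := by
    intro τ hτ
    have h := hasDerivWithinAt_sum_norm_sq_scalar (hα τ hτ)
    have hz : ∑ k, 2 * (conj (α τ k) * transportGalerkinRHS S (b τ) (α τ) k).re = 0 := by
      rw [← Finset.mul_sum, ← Complex.re_sum, sum_conj_mul_transportGalerkinRHS hS (hreal τ hτ) (hb1 τ hτ) (hdiv τ hτ),
        Complex.zero_re, mul_zero]
    rwa [hz] at h
  have hdiff : DifferentiableOn ℝ (fun τ => ∑ k, ‖α τ k‖ ^ 2) (Icc 0 s) := fun τ hτ =>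
    (hderiv τ hτ).differentiableWithinAt
  exact constant_of_derivWithin_zero hdiff
    (fun τ hτ => (hderiv τ (Ico_subset_Icc_self hτ)).derivWithin (uniqueDiffOn_Icc hs τ (Ico_subset_Icc_self hτ)))
    t ht

/-- **Global existence of real Galerkin solutions with conserved `L²` norm** (the truncated
transport equation is a linear ODE with continuous coefficients; energy conservation provides the a
priori bound; `Literature.Analysis.ODE.exists_solution_of_apriori_bound`). Let `S` be symmetric
and let `b : ℝ → (T^d → ℝ^d)` have integrable slices with `∫ ‖b t‖ ≤ B` for `t ≥ 0`, be weakly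
continuous into `L²` on every `[0,T]`, and weakly divergence free for every `t ≥ 0`. Then for
every real `c₀` there is `α : ℝ → (S → ℂ)`, `α 0 = c₀`, real valued, solving `α' = G(b(t), α)` on
every `[0,T]`, with `∑_k ‖α t k‖² = ∑_k ‖c₀ k‖²` for all `t ≥ 0`. [folklore] -/
theorem exists_transportGalerkin_solution (hS : ∀ k ∈ S, -k ∈ S)
    {b : ℝ → UnitAddTorus d → EuclideanSpace ℝ d} (hb1 : ∀ t, 0 ≤ t → Integrable (b t) volume)
    {B : ℝ} (hB : ∀ t, 0 ≤ t → ∫ x, ‖b t x‖ ≤ B)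
    (hbc : ∀ T : ℝ, ∀ g : UnitAddTorus d → EuclideanSpace ℝ d, MemLp g 2 volume →
      ContinuousOn (fun t => ∫ x, ⟪b t x, g x⟫_ℝ) (Icc 0 T))
    (hdiv : ∀ t, 0 ≤ t → IsWeaklyDivFree (b t))
    {c₀ : ↥S → ℂ} (hc₀ : IsRealScalarCoeff c₀) :
    ∃ α : ℝ → ↥S → ℂ, α 0 = c₀ ∧ (∀ t, IsRealScalarCoeff (α t)) ∧
      (∀ T, ∀ t ∈ Icc 0 T, HasDerivWithinAt α (transportGalerkinRHS S (b t) (α t)) (Icc 0 T) t) ∧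
      ∀ t, 0 ≤ t → ∑ k, ‖α t k‖ ^ 2 = ∑ k, ‖c₀ k‖ ^ 2 := by
  let V : ℝ → realScalarSubspace S → realScalarSubspace S := fun t c =>
    ⟨transportGalerkinRHS S (b t) (c : ↥S → ℂ), transportGalerkinRHS_mem (b t) (c : ↥S → ℂ)⟩
  have hVcoe : ∀ t (c : realScalarSubspace S), ((V t c : realScalarSubspace S) : ↥S → ℂ) =
      transportGalerkinRHS S (b t) (c : ↥S → ℂ) := fun t c => rfl
  have hB0 : 0 ≤ B := (integral_nonneg fun x => norm_nonneg _).trans (hB 0 le_rfl)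
  -- Lipschitz on balls (indeed globally), uniformly in time
  have hlip : ∀ T ρ : ℝ, ∃ K : ℝ≥0, ∀ t ∈ Icc 0 T, LipschitzOnWith K (V t) (closedBall 0 ρ) := by
    intro T ρ
    refine ⟨Real.toNNReal (galerkinConst S * B), fun t ht => ?_⟩
    refine LipschitzOnWith.of_dist_le_mul fun c _ c' _ => ?_
    rw [Subtype.dist_eq, dist_eq_norm, dist_eq_norm, hVcoe, hVcoe, ← transportGalerkinRHS_sub (hb1 t ht.1)]
    have h := norm_transportGalerkinRHS_le (hb1 t ht.1) ((c : ↥S → ℂ) - (c' : ↥S → ℂ))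
    refine h.trans (mul_le_mul_of_nonneg_right ?_ (norm_nonneg _))
    exact (mul_le_mul_of_nonneg_left (hB t ht.1) galerkinConst_nonneg).trans (Real.le_coe_toNNReal _)
  -- continuity in time
  have hcont : ∀ c : realScalarSubspace S, ContinuousOn (V · c) (Ici 0) := by
    intro c t ht
    have h := continuousOn_transportGalerkinRHS (T := t + 1) (fun τ hτ => hb1 τ hτ.1) (hbc (t + 1)) (c : ↥S → ℂ)
    have hmem : Icc 0 (t + 1) ∈ 𝓝[Ici 0] t :=
      Filter.mem_of_superset (inter_mem_nhdsWithin (Ici (0 : ℝ)) (Iio_mem_nhds (by linarith)))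
        fun s hs => ⟨hs.1, hs.2.le⟩
    have h' : ContinuousOn (fun τ => V τ c) (Icc 0 (t + 1)) :=
      Topology.IsInducing.subtypeVal.continuousOn_iff.2 h
    exact (h' t ⟨ht, by linarith⟩).mono_of_mem_nhdsWithin hmem
  -- a priori bound from energy conservation
  have hapriori : ∀ T : ℝ, 0 ≤ T → ∃ R : ℝ, ‖(⟨c₀, hc₀⟩ : realScalarSubspace S)‖ ≤ R ∧
      ∀ s ∈ Icc 0 T, ∀ α : ℝ → realScalarSubspace S, α 0 = ⟨c₀, hc₀⟩ →
        (∀ t ∈ Icc 0 s, HasDerivWithinAt α (V t (α t)) (Icc 0 s) t) → ∀ t ∈ Icc 0 s, ‖α t‖ ≤ R := by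
    intro T _
    refine ⟨Real.sqrt (∑ k, ‖c₀ k‖ ^ 2), norm_le_sqrt_sum_norm_sq_scalar c₀, ?_⟩
    intro s hs α hα0 hα t ht
    set β : ℝ → ↥S → ℂ := fun τ => (α τ : ↥S → ℂ) with hβ
    have hβ' : ∀ τ ∈ Icc 0 s, HasDerivWithinAt β (transportGalerkinRHS S (b τ) (β τ)) (Icc 0 s) τ := fun τ hτ =>
      (realScalarSubspace S).subtypeL.hasFDerivAt.comp_hasDerivWithinAt τ (hα τ hτ)
    have hcons := sum_norm_sq_eq_of_solution hS (fun τ hτ => hb1 τ hτ.1) (fun τ hτ => hdiv τ hτ.1) hβ'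
      (fun τ _ => (α τ).2) t ht
    have hβ0 : β 0 = c₀ := by simp [hβ, hα0]
    rw [hβ0] at hcons
    change ‖β t‖ ≤ _
    rw [← hcons]
    exact norm_le_sqrt_sum_norm_sq_scalar (β t)
  obtain ⟨α, hα0, hα⟩ := Literature.Analysis.ODE.exists_solution_of_apriori_bound hlip hcont hapriori
  have hsol : ∀ T, ∀ t ∈ Icc 0 T, HasDerivWithinAt (fun τ => (α τ : ↥S → ℂ))
      (transportGalerkinRHS S (b t) (α t : ↥S → ℂ)) (Icc 0 T) t := fun T t ht =>
    (realScalarSubspace S).subtypeL.hasFDerivAt.comp_hasDerivWithinAt t (hα T t ht)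
  refine ⟨fun t => (α t : ↥S → ℂ), by simp [hα0], fun t => (α t).2, hsol, fun t ht => ?_⟩
  have h := sum_norm_sq_eq_of_solution hS (fun τ hτ => hb1 τ hτ.1) (fun τ hτ => hdiv τ hτ.1) (hsol t)
    (fun τ _ => (α τ).2) t ⟨ht, le_rfl⟩
  simpa [hα0] using h

end Existence

end Torus

end Literature.Analysis.FluidPDE

end
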